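/-
Copyright (c) 2026 the pub-hodgecm-mathlib formalisation cell (harness21).  Prover seat hodgecm-mathlib-LH4-p13 (g0): Track A «(D-RAM) FOUR-FRAME» squad of crux H413
(dealer LH4-plan (g10) WORD #29 «p13 → (e) `stub_U2H_typeTwoRow_wild`»; LH4-p05 (g0) CENSUS v2 (f) «type dichotomy»), 2026-09-03.
-/
import Literature.NumberTheory.Automorphic.UnitaryTwoRamifiedFixedSelfDualVerticesUnitType       -- ★ p855177 (this seat): the √u-type VERTEX column `#Fix_{γ₂}(U₂ ⧸ K₂) = #{x | g·x = x}`; brings (W2)-Place, the tree action, ★ B-p14 transport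
import Literature.NumberTheory.Rogawski1990.DepthZeroTransferHValuesTypeTwoRamified                 -- ★ (A-p12 (g23)): `natCard_fixedBy_eq_ncard_fixedBy_onePlace` (transport `U₂ ⧸ C′ → U_w ⧸ K♯_η`)
import HarnessLib

/-!
# The number of `ϖ`-MODULAR cosets fixed by an element of `U(Φ₂)` at a ramified place of `√u`-TYPE (anti-fixed UNIT) is a count of set-wise fixed EDGES of the tree of
# `SL₂(L⁺_v)`: `#Fix_{γ₂}(U₂ ⧸ K♯) = #{e | g·e = e}`, `g` any projective descent of `E₂ γ₂` (Tits 1979 §2.7, §3.2; Serre, *Trees* I §6.1, II §1.3; Kottwitz 1988 §2)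

Topic `NumberTheory/Automorphic`; namespace `Literature.NumberTheory.Automorphic.UnitaryGroup` (as ★ `UnitaryTwoRamifiedEllipticFixedModularVertices`, ★ p855177).  THEOREMS ONLY
(no definition, no instance, no notation, no named fact, no `sorry`); kernel lane `--supports stmt-HodgeConjecture-24833`.  Cell `pub/hodgecm-mathlib` (D-0151), crux H413;
Track A «(D-RAM) FOUR-FRAME», unit U2H (ii-H), child (e) `stub_U2H_typeTwoRow_wild` (dealer LH4-plan (g10) WORD #29; LH4-p06 (g0) ED. 4∕5 design (e₀)); the WILD groundwork
under ★ p855119 `F0P3cDyRamHProfilesTypeTwoUnfolding` (`Φ^st(γ_H, hFamily 1) = ν_H(K♯ × U₁) · #Fix_{γ₂}(U₂ ⧸ K♯)` at ANY ramified place).  The EDGE companion of ★ p855177 (there: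
`K₂` ↔ vertices at a √u-type place).  HONEST LABEL: HC_CM is proved only modulo the 7 printed citations (2 remaining named inputs: hLiu418 = stmt-HodgeConjecture-24832, h413 =
stmt-HodgeConjecture-24833) until rung 0 closes; nothing printed is asserted here — transport along ★ theorems; the census of the fixed edge set (a ball governed by the
eigen-order conductor at a dyadic place) is NOT here.

THE MATHEMATICS.  At a ramified non-split `w ∣ v` of √u-TYPE (`α ∈ L_w` anti-fixed with `|α| = 1`; `d = v_w(𝔇)` even) the `ϖ`-modular level `K♯_η = U_w ∩ D_η GL₂(𝒪_w) D_η⁻¹`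
(`η` any uniformiser of `L_w`) is the SET-WISE stabiliser of the reference EDGE `{v₀, v₁}` = `{𝒪_v², 𝒪_v ⊕ ϖ_F 𝒪_v}` of the tree of `SL₂(L⁺_v)` under `ρ_w` (★ (W2)-Place
`forall_coe_mem_map_conj_glDiagonal_iff_sym2_rhoVertexActPlace_eq`; it contains the inversion `(0, (σ_wη)⁻¹; η, 0)`), whereas at a √π-type place it is a VERTEX stabiliser (★
p847070).  `U_w` acts on the tree by graph automorphisms (★ `latticeTree_adj_rhoVertexActPlace_iff`) with ONE DART ORBIT at a ramified place (★ `exists_rhoVertexActPlace_eq_of_adj`),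
and `{v₀, v₁}` is an edge (★ `latticeTree_adj_root`).  Hence ★ B-p14's edge orbit–stabiliser transport `ncard_fixedBy_quotient_eq_of_edgeAction` gives
`#Fix_u(U_w ⧸ K♯_η) = #{e ∈ E(X) | ρ_w(u)·e = e}` (edges fixed SET-WISE, inversions allowed), and `ρ_w(u) = (g · )` for any descent representative `g` (★
`rhoVertexActPlace_eq_glVertexAct`); on the CM carrier, `#Fix_{γ₂}(U₂ ⧸ C′) = #Fix_{E₂γ₂}(U_w ⧸ K♯_η)` for `C′` matched with `K♯_η` (★ `natCard_fixedBy_eq_ncard_fixedBy_onePlace`).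

* §1 `ncard_fixedBy_quotient_comap_modular_eq_ncard_fixedEdges_of_v_eq_one` — one-place model, √u-type: the `K♯`-coset count is the set-wise fixed-edge count.
* §2 **`natCard_fixedBy_modular_eq_ncard_fixedEdges_of_v_eq_one`** — THE HEAD on `U₂ = U(Φ₂)(L⁺_v)`: `#Fix_{γ₂}(U₂ ⧸ C′) = #{e | g·e = e}` at a √u-type ramified place.

## References
* [Tits1979] J. Tits, *Reductive groups over local fields*, PSPM 33.1 (1979), §2.7 p. 48, §3.2 p. 50 (quasi-split `U(1,1)`: the tree of `SL₂`; maximal bounded subgroups =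
  vertex and edge stabilisers).
* [Serre1980Trees] J.-P. Serre, *Trees* (1980), Ch. I §6.1 (orbit–stabiliser), Ch. II §1.1–§1.3 (the tree of `SL₂` over a local field; inversions).
* [Kottwitz1988] R. E. Kottwitz, *Tamagawa numbers*, Ann. of Math. 127 (1988), §2 (orbital integrals of indicators as fixed-coset counts).
* [Kottwitz1986] R. E. Kottwitz, *Base change for unit elements of Hecke algebras*, Compositio Math. 60 (1986), §3 (fixed cosets read on the building).
-/

set_option autoImplicit false

noncomputable section

open scoped WithZero ValuativeRel Matrix MatrixGroups
open Matrix WithZero ValuativeRel NumberField IsDedekindDomain MulAction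

namespace Literature.NumberTheory.Automorphic.UnitaryGroup

open Literature.NumberTheory.Automorphic Literature.NumberTheory.Automorphic.HermitianLatticeTree Literature.GroupTheory

section Place

variable (L : Type) [Field L] [NumberField L] [IsCMField L] (v : HeightOneSpectrum (𝓞 ↥(maximalRealSubfield L)))
  (w : PlacesOver L v) (hw : IsCMField.complexConj L • w.1 = w.1)
  {α : w.1.adicCompletion L} (hα : galAdicCompletionMap (L := L) (IsCMField.complexConj L) hw α = -α) (hα0 : α ≠ 0)
  {ϖF : v.adicCompletion ↥(maximalRealSubfield L)} (hϖF : Valued.v ϖF = exp (-1 : ℤ))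

/-! ## §1 The `K♯`-coset count as a set-wise fixed-edge count at a √u-type place -/

include hα hα0 in
/-- **THE `K♯`-COSET COUNT IS A SET-WISE FIXED-EDGE COUNT AT A √u-TYPE RAMIFIED PLACE** (`α` an anti-fixed UNIT, `|α| = 1`; `η` any uniformiser of `L_w`): for EVERY `u ∈ U_w`
and any descent representative `(s, g)` (`diag(1,α) u diag(1,α)⁻¹ = s · ι_w(g)`), `#Fix_u(U_w ⧸ K♯_η) = #{e ∈ E(X) | (g · ) e = e}` — `X` the tree of `SL₂(L⁺_v)`, edges fixed
SET-WISE (an inverted edge counts), `Set.ncard` on both sides; `K♯_η = U_w ∩ D_η GL₂(𝒪_w) D_η⁻¹` pulled back along `U_w ≤ GL₂(L_w)`.  Edge transport ★ B-p14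
`ncard_fixedBy_quotient_eq_of_edgeAction` over: automorphisms ★ `latticeTree_adj_rhoVertexActPlace_iff`, the reference edge ★ `latticeTree_adj_root`, one dart orbit ★
`exists_rhoVertexActPlace_eq_of_adj`, edge stabiliser ★ (W2)-Place `forall_coe_mem_map_conj_glDiagonal_iff_sym2_rhoVertexActPlace_eq`; then `ρ_w(u) = (g · )` ★
`rhoVertexActPlace_eq_glVertexAct`. [cite: Serre1980Trees, Ch. I §6.1; Ch. II §1.3] [cite: Tits1979, §3.2 p. 50] [cite: Kottwitz1988, §2] [cite: Kottwitz1986, §3] -/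
theorem ncard_fixedBy_quotient_comap_modular_eq_ncard_fixedEdges_of_v_eq_one (he : v.asIdeal.ramificationIdx' w.1.asIdeal ≠ 1) (hvα : Valued.v α = 1)
    (η : (w.1.adicCompletion L)ˣ) (hη : Valued.v (η : w.1.adicCompletion L) = exp (-1 : ℤ))
    (u : ↥(unitaryGroupOfForm (galAdicCompletionMap (L := L) (IsCMField.complexConj L) hw)
      (placeForm (Matrix.of fun i j : Fin 2 => if i.val + j.val + 1 = 2 then (1 : L) else 0) w.1)))
    {s : w.1.adicCompletion L} {g : GL (Fin 2) (v.adicCompletion ↥(maximalRealSubfield L))} (hs : s ≠ 0)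
    (hsg : Matrix.diagonal ![1, α] * ((u : GL (Fin 2) (w.1.adicCompletion L)) : Matrix (Fin 2) (Fin 2) (w.1.adicCompletion L)) * Matrix.diagonal ![1, α⁻¹] =
      s • (g : Matrix (Fin 2) (Fin 2) (v.adicCompletion ↥(maximalRealSubfield L))).map (toPlace v w)) :
    (fixedBy (↥(unitaryGroupOfForm (galAdicCompletionMap (L := L) (IsCMField.complexConj L) hw)
        (placeForm (Matrix.of fun i j : Fin 2 => if i.val + j.val + 1 = 2 then (1 : L) else 0) w.1)) ⧸
        (((glInt 2 (w.1.adicCompletion L)).map (MulAut.conj (glDiagonal 2 (w.1.adicCompletion L) ![1, η])).toMonoidHom).comap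
          (unitaryGroupOfForm (galAdicCompletionMap (L := L) (IsCMField.complexConj L) hw)
            (placeForm (Matrix.of fun i j : Fin 2 => if i.val + j.val + 1 = 2 then (1 : L) else 0) w.1)).subtype)) u).ncard =
      {e : (latticeTree (RingHom.id (v.adicCompletion ↥(maximalRealSubfield L))) ϖF !![(0 : v.adicCompletion ↥(maximalRealSubfield L)), 1; -1, 0]).edgeSet |
          Sym2.map (glVertexAct (isUniformizingElement_of_v_eq hϖF) g)
            (e : Sym2 {M : Submodule 𝒪[v.adicCompletion ↥(maximalRealSubfield L)] (Fin 2 → v.adicCompletion ↥(maximalRealSubfield L)) //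
              IsSpecialLattice (RingHom.id _) ϖF !![(0 : v.adicCompletion ↥(maximalRealSubfield L)), 1; -1, 0] M}) = e}.ncard := by
  haveI : IsDiscreteValuationRing 𝒪[v.adicCompletion ↥(maximalRealSubfield L)] := isDiscreteValuationRing_integer_of_compatible hϖF
  have h0 : ϖF ≠ 0 := (isUniformizingElement_of_v_eq hϖF).ne_zero
  -- the reference edge `{v₀, v₁}` = `{latt 1, latt diag(1, ϖ_F)}`
  have hsd : IsSpecialLattice (RingHom.id _) ϖF !![(0 : v.adicCompletion ↥(maximalRealSubfield L)), 1; -1, 0]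
      (latt (1 : Matrix (Fin 2) (Fin 2) (v.adicCompletion ↥(maximalRealSubfield L)))) :=
    Or.inl ((isSelfDualLattice_id_altJ_iff _).2 ⟨1, by rw [Units.val_one], by rw [Units.val_one, det_one, map_one]⟩)
  have hdet1 : (Matrix.diagonal ![(1 : v.adicCompletion ↥(maximalRealSubfield L)), ϖF]).det ≠ 0 := by
    rw [Matrix.det_diagonal, Fin.prod_univ_two]; simpa using h0
  have hmod : IsSpecialLattice (RingHom.id _) ϖF !![(0 : v.adicCompletion ↥(maximalRealSubfield L)), 1; -1, 0]
      (latt (Matrix.diagonal ![(1 : v.adicCompletion ↥(maximalRealSubfield L)), ϖF])) := by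
    refine Or.inr ((isModularLattice_id_altJ_iff h0 _).2 ⟨Matrix.GeneralLinearGroup.mk'' _ (isUnit_iff_ne_zero.2 hdet1), rfl, ?_⟩)
    show valuation _ (Matrix.diagonal ![(1 : v.adicCompletion ↥(maximalRealSubfield L)), ϖF]).det = valuation _ ϖF
    rw [Matrix.det_diagonal, Fin.prod_univ_two]; simp
  set v₀ : {M : Submodule 𝒪[v.adicCompletion ↥(maximalRealSubfield L)] (Fin 2 → v.adicCompletion ↥(maximalRealSubfield L)) //
      IsSpecialLattice (RingHom.id _) ϖF !![(0 : v.adicCompletion ↥(maximalRealSubfield L)), 1; -1, 0] M} := ⟨_, hsd⟩ with hv₀def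
  set v₁ : {M : Submodule 𝒪[v.adicCompletion ↥(maximalRealSubfield L)] (Fin 2 → v.adicCompletion ↥(maximalRealSubfield L)) //
      IsSpecialLattice (RingHom.id _) ϖF !![(0 : v.adicCompletion ↥(maximalRealSubfield L)), 1; -1, 0] M} := ⟨_, hmod⟩ with hv₁def
  have hv₀ : v₀.1 = latt (1 : Matrix (Fin 2) (Fin 2) (v.adicCompletion ↥(maximalRealSubfield L))) := rfl
  have hv₁ : v₁.1 = latt (Matrix.diagonal ![(1 : v.adicCompletion ↥(maximalRealSubfield L)), ϖF]) := rfl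
  have h01 : (latticeTree (RingHom.id (v.adicCompletion ↥(maximalRealSubfield L))) ϖF !![(0 : v.adicCompletion ↥(maximalRealSubfield L)), 1; -1, 0]).Adj v₀ v₁ :=
    latticeTree_adj_root (isUniformizingElement_of_v_eq hϖF) v₀ v₁ hv₀ hv₁
  -- automorphisms, one dart orbit, the set-wise edge stabiliser (√u-type)
  have hadj := latticeTree_adj_rhoVertexActPlace_iff L v w hw hα hα0 hϖF
  have hD : ∀ a b : {M : Submodule 𝒪[v.adicCompletion ↥(maximalRealSubfield L)] (Fin 2 → v.adicCompletion ↥(maximalRealSubfield L)) //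
      IsSpecialLattice (RingHom.id _) ϖF !![(0 : v.adicCompletion ↥(maximalRealSubfield L)), 1; -1, 0] M},
      (latticeTree (RingHom.id (v.adicCompletion ↥(maximalRealSubfield L))) ϖF !![(0 : v.adicCompletion ↥(maximalRealSubfield L)), 1; -1, 0]).Adj a b →
      ∃ u' : ↥(unitaryGroupOfForm (galAdicCompletionMap (L := L) (IsCMField.complexConj L) hw)
        (placeForm (Matrix.of fun i j : Fin 2 => if i.val + j.val + 1 = 2 then (1 : L) else 0) w.1)),
        rhoVertexActPlace L v w hw hα hα0 hϖF u' v₀ = a ∧ rhoVertexActPlace L v w hw hα hα0 hϖF u' v₁ = b :=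
    fun a b hab => exists_rhoVertexActPlace_eq_of_adj L v w hw hα hα0 hϖF he v₀ v₁ hv₀ hv₁ hab
  have hKe := forall_coe_mem_map_conj_glDiagonal_iff_sym2_rhoVertexActPlace_eq L v w hw hα hα0 hϖF v₀ v₁ hv₀ hv₁ he hvα η hη
  have hcount := ncard_fixedBy_quotient_eq_of_edgeAction (rhoVertexActPlace L v w hw hα hα0 hϖF) (rhoVertexActPlace_one L v w hw hα hα0 hϖF)
    (rhoVertexActPlace_mul L v w hw hα hα0 hϖF) hadj h01 hD
    ((((glInt 2 (w.1.adicCompletion L)).map (MulAut.conj (glDiagonal 2 (w.1.adicCompletion L) ![1, η])).toMonoidHom).comap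
      (unitaryGroupOfForm (galAdicCompletionMap (L := L) (IsCMField.complexConj L) hw)
        (placeForm (Matrix.of fun i j : Fin 2 => if i.val + j.val + 1 = 2 then (1 : L) else 0) w.1)).subtype))
    (fun g' => by rw [Subgroup.mem_comap, Subgroup.coe_subtype]; exact hKe g') u
  -- `ρ_w(u) = (g · )`
  have hρ : rhoVertexActPlace L v w hw hα hα0 hϖF u = glVertexAct (isUniformizingElement_of_v_eq hϖF) g :=
    funext fun M => rhoVertexActPlace_eq_glVertexAct L v w hw hα hα0 hϖF u hs hsg M
  rw [hρ] at hcount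
  exact hcount

/-! ## §2 The head on the CM carrier `U₂ = U(Φ₂)(L⁺_v)` -/

include hα hα0 in
/-- **THE `ϖ`-MODULAR FIXED-COSET COUNT AT A √u-TYPE RAMIFIED PLACE IS A SET-WISE FIXED-EDGE COUNT**: `w ∣ v` ramified non-split, `α ∈ L_w` an anti-fixed UNIT (`σ_w α = −α`,
`|α| = 1` — the wild places of type `L⁺_v(√u)`, `d` even), `η` a uniformiser of `L_w` (as a unit), `ϖ_F` a uniformiser of `L⁺_v`, `C′ ≤ U₂` the subgroup matched by `E₂` with
`D_η GL₂(𝒪_w) D_η⁻¹` (the `K♯` of ★ DEFS LEAF №5 ∕ ★ `exists_vertexCover_of_ramified_wild`); for `γ₂ ∈ U₂` and any descent representative `(s, g)` of `E₂ γ₂`: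
**`#Fix_{γ₂}(U₂ ⧸ C′) = #{e ∈ E(X) | (g · ) e = e}`** (★ `natCard_fixedBy_eq_ncard_fixedBy_onePlace`, then §1).  With ★ p855119 this reads
`Φ^st(γ_H, hFamily 1) = ν_H(K♯ × U₁) · #{set-wise fixed edges of g}` on the type-(2) population at a √u-type place (and ★ p855177 gives the vertex column for `hFamily 0`); the ball
census of the fixed edge set by the conductor of the eigen-order of `g` is the (ii-H) type-(2) law debt. [cite: Tits1979, §2.7 p. 48, §3.2 p. 50] [cite: Serre1980Trees, Ch. I §6.1; Ch. II §1.3]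
[cite: Kottwitz1988, §2] [cite: Kottwitz1986, §3] -/
theorem natCard_fixedBy_modular_eq_ncard_fixedEdges_of_v_eq_one (he : v.asIdeal.ramificationIdx' w.1.asIdeal ≠ 1) (hvα : Valued.v α = 1)
    (η : (w.1.adicCompletion L)ˣ) (hη : Valued.v (η : w.1.adicCompletion L) = exp (-1 : ℤ))
    (C' : Subgroup ((cmDatum L 2 (Matrix.of fun i j : Fin 2 => if i.val + j.val + 1 = 2 then (1 : L) else 0)).Local v))
    (hC' : ∀ g', g' ∈ C' ↔ (((localNonsplitEquiv (IsCMField.complexConj L) (Matrix.of fun i j : Fin 2 => if i.val + j.val + 1 = 2 then (1 : L) else 0) (IsCMField.complexConj_ne_one L) w hw) g' : ↥(unitaryGroupOfForm (galAdicCompletionMap (L := L) (IsCMField.complexConj L) hw) (placeForm (Matrix.of fun i j : Fin 2 => if i.val + j.val + 1 = 2 then (1 : L) else 0) w.1))) : GL (Fin 2) (w.1.adicCompletion L)) ∈ (glInt 2 (w.1.adicCompletion L)).map (MulAut.conj (glDiagonal 2 (w.1.adicCompletion L) ![1, η])).toMonoidHom)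
    (γ₂ : ((cmDatum L 2 (Matrix.of fun i j : Fin 2 => if i.val + j.val + 1 = 2 then (1 : L) else 0)).Local v))
    {s : w.1.adicCompletion L} {g : GL (Fin 2) (v.adicCompletion ↥(maximalRealSubfield L))} (hs : s ≠ 0)
    (hsg : Matrix.diagonal ![1, α] * ((((localNonsplitEquiv (IsCMField.complexConj L) (Matrix.of fun i j : Fin 2 => if i.val + j.val + 1 = 2 then (1 : L) else 0) (IsCMField.complexConj_ne_one L) w hw) γ₂ : ↥(unitaryGroupOfForm (galAdicCompletionMap (L := L) (IsCMField.complexConj L) hw) (placeForm (Matrix.of fun i j : Fin 2 => if i.val + j.val + 1 = 2 then (1 : L) else 0) w.1))) : GL (Fin 2) (w.1.adicCompletion L)) : Matrix (Fin 2) (Fin 2) (w.1.adicCompletion L)) * Matrix.diagonal ![1, α⁻¹] =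
      s • (g : Matrix (Fin 2) (Fin 2) (v.adicCompletion ↥(maximalRealSubfield L))).map (toPlace v w)) :
    Nat.card (fixedBy (((cmDatum L 2 (Matrix.of fun i j : Fin 2 => if i.val + j.val + 1 = 2 then (1 : L) else 0)).Local v) ⧸ C') γ₂) =
      {e : (latticeTree (RingHom.id (v.adicCompletion ↥(maximalRealSubfield L))) ϖF !![(0 : v.adicCompletion ↥(maximalRealSubfield L)), 1; -1, 0]).edgeSet |
          Sym2.map (glVertexAct (isUniformizingElement_of_v_eq hϖF) g)
            (e : Sym2 {M : Submodule 𝒪[v.adicCompletion ↥(maximalRealSubfield L)] (Fin 2 → v.adicCompletion ↥(maximalRealSubfield L)) //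
              IsSpecialLattice (RingHom.id _) ϖF !![(0 : v.adicCompletion ↥(maximalRealSubfield L)), 1; -1, 0] M}) = e}.ncard := by
  rw [natCard_fixedBy_eq_ncard_fixedBy_onePlace L v w hw η C' hC' γ₂]
  exact ncard_fixedBy_quotient_comap_modular_eq_ncard_fixedEdges_of_v_eq_one L v w hw hα hα0 hϖF he hvα η hη _ hs hsg

end Place

end Literature.NumberTheory.Automorphic.UnitaryGroup

end
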